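import Summits.NavierStokesRegularity.NavierStokesRegularity.Theses.CorkscrewDynamo
import Summits.NavierStokesRegularity.NavierStokesRegularity.Theorems.CorkscrewDynamoClassicalCorkscrewSuffices
import Summits.NavierStokesRegularity.NavierStokesRegularity.Theorems.CorkscrewDynamoCorkscrewProfileCorotatingFrame
import Literature.Analysis.FluidPDE.AncientSimilarityVariables

/-!
# Route CorkscrewDynamo · crux `CorkscrewProfile` (stmt-NavierStokesRegularity-11282) — the birth-line reduction

**A non-axisymmetric relative equilibrium of Leray's backward system suffices for a corkscrew.**
This file closes the composition of the line `birth` (`Cruxes/CorkscrewProfile/Lines/birth.lean`) modulo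
its single open stub: if there are a rotation family `Rot` about `e₃` pinned by coordinates, an angular
velocity `ω`, a period `L > 0`, a constant `C` and a smooth divergence-free profile `V` with smooth pressure
`Q` solving the steady backward Leray system in the frame rotating with angular velocity `ω`,

  `ω (e₃ × V − DV·(e₃ × y)) + ½ V + ½ (y·∇)V + (V·∇)V + ∇Q = ΔV`,  `div V = 0`,        (RE_ω)

inside the Type-I envelope `(1 + ‖y‖)‖V y‖ ≤ C`, `|Q y| ≤ C`, and NOT invariant under the rotation by the
angle `ωL`, then `CorkscrewDynamo.CorkscrewProfile` holds. Proof: the co-rotating frame dictionary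
(`stub_corotatingFrame`, landed) makes `U(s,y) = R_{ωs} V(R_{−ωs} y)`, `P(s,y) = Q(R_{−ωs} y)` a classical
solution of the backward Leray system on `ℝ × ℝ³`; it is periodic modulo the rotation `R = R_{−ωL}`,
`U(s + L) = R⁻¹ U(s, R ·)`; unwinding to physical variables (`ofLerayOrbit`, `ofLerayOrbitPressure`,
`isClassicalNSSolutionOn_Iio_ofLerayOrbit_iff`, `lerayOrbit_add_eq_symm_iff`, `hasTypeIDecay_iff_lerayOrbit`,
`periodic_lerayOrbit_iff`) gives the data of the landed pad `ClassicalCorkscrewSuffices`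
(`Theorems.classicalCorkscrewSuffices_proof`, stmt-11285): a classical solution on `(−∞,0)`, rotated
`λ`-DSS with `λ = e^{L/2}`, Type I with constant `C`, pressure bounded by `C/(−t)` on past slabs, and not
plainly `λ`-DSS at some past point (else `V` would be `R_{ωL}`-invariant).

The remaining stub `stub_relativeEquilibrium` (existence of such a relative equilibrium) is the open
existence problem for Type-I rotating self-similar profiles (Bradshaw–Tsai 2017 Open Problem 5.1 /
Tsai 2018 Conj. 8.8–8.9, negative side; Pineau–Vicol 2026 Thm 1.4 removes only `|ω|` small or large for
fixed `C`); this file records that it is ALL that is missing.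
-/

noncomputable section

open Set Function Literature.Analysis.FluidPDE

namespace Summit.NavierStokesRegularity.NavierStokesRegularity.Theorems.CorkscrewProfile.Birth

set_option linter.dupNamespace false

/-- Group law of a rotation family about `e₃` pinned by coordinates: `R_a (R_b x) = R_{a+b} x`. -/
theorem rot_add_apply (Rot : ℝ → ((EuclideanSpace ℝ (Fin 3)) ≃ₗᵢ[ℝ] (EuclideanSpace ℝ (Fin 3))))
    (hRot : ∀ (φ : ℝ) (x : (EuclideanSpace ℝ (Fin 3))), Rot φ x 0 = Real.cos φ * x 0 - Real.sin φ * x 1 ∧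
        Rot φ x 1 = Real.sin φ * x 0 + Real.cos φ * x 1 ∧ Rot φ x 2 = x 2)
    (a b : ℝ) (x : (EuclideanSpace ℝ (Fin 3))) : Rot a (Rot b x) = Rot (a + b) x := by
  rw [rot_eq_rotZ Rot hRot, rot_eq_rotZ Rot hRot, rot_eq_rotZ Rot hRot, ← rotZ_add]

/-- `R_0 = 1` for a rotation family about `e₃` pinned by coordinates. -/
theorem rot_zero_apply (Rot : ℝ → ((EuclideanSpace ℝ (Fin 3)) ≃ₗᵢ[ℝ] (EuclideanSpace ℝ (Fin 3))))
    (hRot : ∀ (φ : ℝ) (x : (EuclideanSpace ℝ (Fin 3))), Rot φ x 0 = Real.cos φ * x 0 - Real.sin φ * x 1 ∧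
        Rot φ x 1 = Real.sin φ * x 0 + Real.cos φ * x 1 ∧ Rot φ x 2 = x 2)
    (x : (EuclideanSpace ℝ (Fin 3))) : Rot 0 x = x := by
  rw [rot_eq_rotZ Rot hRot, rotZ_zero]

/-- **The rotating wave of a relative equilibrium, unwound to physical variables.** For the rotation
family about `e₃` pinned by coordinates and a smooth divergence-free solution `(V, Q)` of the rotating
steady Leray system (RE_ω) with `(1 + ‖y‖)‖V y‖ ≤ C`, `|Q y| ≤ C`, and any real `L`: the physical field
`u = ofLerayOrbit U` of the rotating wave `U(s,y) = R_{ωs} V(R_{−ωs} y)` with pressure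
`p = ofLerayOrbitPressure P`, `P(s,y) = Q(R_{−ωs} y)`, is a classical Navier–Stokes solution (`ν = 1`,
`f = 0`) on `(−∞,0)` (frame dictionary `stub_corotatingFrame` + `isClassicalNSSolutionOn_Iio_ofLerayOrbit_iff`),
rotated `e^{L/2}`-DSS with the rotation `R_{−ωL}` (twisted periodicity `U(s + L) = R_{ωL} U(s, R_{−ωL}·)` and
`lerayOrbit_add_eq_symm_iff`; junk `t ≥ 0`: `0 = 0`), Type I with constant `C`
(`hasTypeIDecay_iff_lerayOrbit`), with pressure bounded by `C/(−t)` on every past slab, hence an ancient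
mild solution (`isAncientMildSolution_of_classical_Iio`, Fabes–Jones–Rivière); and its slice at `t = −1`
is `V` itself. -/
theorem rotatingWave_data
    (Rot : ℝ → (EuclideanSpace ℝ (Fin 3) ≃ₗᵢ[ℝ] EuclideanSpace ℝ (Fin 3))) (ω : ℝ)
    (V : EuclideanSpace ℝ (Fin 3) → EuclideanSpace ℝ (Fin 3)) (Q : EuclideanSpace ℝ (Fin 3) → ℝ) {C L : ℝ}
    (hRot : ∀ (φ : ℝ) (x : EuclideanSpace ℝ (Fin 3)),
        Rot φ x 0 = Real.cos φ * x 0 - Real.sin φ * x 1 ∧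
        Rot φ x 1 = Real.sin φ * x 0 + Real.cos φ * x 1 ∧ Rot φ x 2 = x 2)
    (hV : ContDiff ℝ (⊤ : ℕ∞) V) (hQ : ContDiff ℝ (⊤ : ℕ∞) Q)
    (hdiv : Literature.Analysis.FluidPDE.VectorCalculus.IsDivFree V)
    (hEq : ∀ y : EuclideanSpace ℝ (Fin 3),
        ω • (Literature.Analysis.FluidPDE.cross (EuclideanSpace.single (2 : Fin 3) (1 : ℝ)) (V y)
              - fderiv ℝ V y (Literature.Analysis.FluidPDE.cross (EuclideanSpace.single (2 : Fin 3) (1 : ℝ)) y))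
          + (1 / 2 : ℝ) • V y + (1 / 2 : ℝ) • fderiv ℝ V y y
          + Literature.Analysis.FluidPDE.convect V V y + gradient Q y
          = Laplacian.laplacian V y)
    (hVb : ∀ y : EuclideanSpace ℝ (Fin 3), (1 + ‖y‖) * ‖V y‖ ≤ C)
    (hQb : ∀ y : EuclideanSpace ℝ (Fin 3), |Q y| ≤ C) :
    Literature.Analysis.FluidPDE.IsClassicalNSSolutionOn (Set.Iio 0) 1 0
        (ofLerayOrbit fun s y => Rot (ω * s) (V (Rot (-(ω * s)) y)))
        (ofLerayOrbitPressure fun s y => Q (Rot (-(ω * s)) y)) ∧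
      Literature.Analysis.FluidPDE.IsRotatedDSS (Real.exp (L / 2)) (Rot (-(ω * L)))
        (ofLerayOrbit fun s y => Rot (ω * s) (V (Rot (-(ω * s)) y))) ∧
      Literature.Analysis.FluidPDE.HasTypeIDecay C (ofLerayOrbit fun s y => Rot (ω * s) (V (Rot (-(ω * s)) y))) ∧
      (∀ t < 0, Literature.Analysis.FluidPDE.IsBoundedOn (Set.Iic t)
        (ofLerayOrbitPressure fun s y => Q (Rot (-(ω * s)) y))) ∧
      Literature.Analysis.FluidPDE.IsAncientMildSolution 1
        (ofLerayOrbit fun s y => Rot (ω * s) (V (Rot (-(ω * s)) y))) ∧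
      (∀ x : EuclideanSpace ℝ (Fin 3), ofLerayOrbit (fun s y => Rot (ω * s) (V (Rot (-(ω * s)) y))) (-1) x = V x) := by
  -- the uniformly rotating profile and its pressure solve the backward Leray system (the frame stub)
  set U : ℝ → (EuclideanSpace ℝ (Fin 3)) → (EuclideanSpace ℝ (Fin 3)) := fun s y => Rot (ω * s) (V (Rot (-(ω * s)) y)) with hU
  set P : ℝ → (EuclideanSpace ℝ (Fin 3)) → ℝ := fun s y => Q (Rot (-(ω * s)) y) with hP
  have hBL : IsBackwardLeraySolutionOn Set.univ 1 U P := stub_corotatingFrame Rot ω V Q hRot hV hQ hdiv hEq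
  -- the factor `λ = e^{L/2}` and the rotation `R = R_{−ωL}`
  set c : ℝ := Real.exp (L / 2) with hc_def
  have hc0 : 0 < c := Real.exp_pos _
  have hlog : 2 * Real.log c = L := by rw [hc_def, Real.log_exp]; ring
  set R : (EuclideanSpace ℝ (Fin 3)) ≃ₗᵢ[ℝ] (EuclideanSpace ℝ (Fin 3)) := Rot (-(ω * L)) with hR
  -- twisted periodicity of the profile
  have hper : ∀ s y, U (s + 2 * Real.log c) y = R.symm (U s (R y)) := by
    intro s y
    have e1 : ω * (s + L) = ω * L + ω * s := by ring
    have e2 : -(ω * (s + L)) = -(ω * s) + -(ω * L) := by ring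
    rw [hlog]
    simp only [hU, hR]
    rw [rot_symm_apply_eq Rot hRot, neg_neg, rot_add_apply Rot hRot, rot_add_apply Rot hRot, e2, e1]
  have hUo : lerayOrbit (ofLerayOrbit U) = U := by
    funext s y
    exact lerayOrbit_ofLerayOrbit U s y
  have hPb : ∀ s y, |P s y| ≤ C := fun s y => hQb _
  have hcl : IsClassicalNSSolutionOn (Set.Iio 0) 1 0 (ofLerayOrbit U) (ofLerayOrbitPressure P) :=
    isClassicalNSSolutionOn_Iio_ofLerayOrbit_iff.2 hBL
  have hTI : HasTypeIDecay C (ofLerayOrbit U) := by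
    refine hasTypeIDecay_iff_lerayOrbit.2 fun s y => ?_
    rw [lerayOrbit_ofLerayOrbit]
    simp only [hU]
    rw [LinearIsometryEquiv.norm_map]
    have key := hVb (Rot (-(ω * s)) y)
    rwa [LinearIsometryEquiv.norm_map] at key
  have hpb : ∀ t < 0, IsBoundedOn (Set.Iic t) (ofLerayOrbitPressure P) := by
    intro t ht
    have h0 : 0 < -t := by linarith
    refine ⟨C / (-t), fun t' ht' x => ?_⟩
    have ht'' : t' ≤ t := ht'
    have h0' : 0 < -t' := by linarith
    rw [ofLerayOrbitPressure_apply, Real.norm_eq_abs, abs_mul, abs_inv, abs_of_pos h0']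
    calc (-t')⁻¹ * |P (-Real.log (-t')) ((Real.sqrt (-t'))⁻¹ • x)|
        ≤ (-t)⁻¹ * C :=
          mul_le_mul (inv_anti₀ h0 (by linarith)) (hPb _ _) (abs_nonneg _) (inv_nonneg.2 h0.le)
      _ = C / (-t) := by rw [div_eq_inv_mul]
  refine ⟨hcl, ?_, hTI, hpb, ?_, ?_⟩
  · -- rotated `λ`-DSS for all times (`t ≥ 0`: junk value `0` on both sides)
    intro t x
    rcases lt_or_ge t 0 with ht | ht
    · exact (lerayOrbit_add_eq_symm_iff hc0 (R := R) (u := ofLerayOrbit U)).1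
        (fun s y => by rw [hUo]; exact hper s y) t ht x
    · have h1 : Real.sqrt (-t) = 0 := Real.sqrt_eq_zero'.2 (by linarith)
      have h2 : Real.sqrt (-(c ^ 2 * t)) = 0 :=
        Real.sqrt_eq_zero'.2 (neg_nonpos.2 (mul_nonneg (sq_nonneg c) ht))
      simp only [ofLerayOrbit_apply, h1, h2, inv_zero, zero_smul, map_zero, smul_zero]
  · -- ancient mild: classical on the past, `u` bounded on past slabs by Type I, `p` by `C/(−t)`
    exact Summit.NavierStokesRegularity.NavierStokesRegularity.Theorems.isAncientMildSolution_of_classical_Iio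
      one_pos hcl
      (fun t ht => Summit.NavierStokesRegularity.NavierStokesRegularity.Theorems.isBoundedOn_Iic_of_hasTypeIDecay hTI ht)
      hpb
  · -- the slice at `t = −1` is the profile
    intro x
    simp only [ofLerayOrbit_apply, hU, neg_neg, Real.sqrt_one, inv_one, one_smul, Real.log_one, neg_zero,
      mul_zero, rot_zero_apply Rot hRot]

/-- **Registered stub `stub_classicalCorkscrewOfRelativeEquilibrium` — from a relative equilibrium to the data of
the landing pad.** A non-`R_{ωL}`-invariant smooth
solution `(V, Q)` of the rotating steady Leray system (RE_ω) in the Type-I envelope yields a classical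
Navier–Stokes solution on `(−∞, 0)` (`ν = 1`, `f = 0`) which is rotated `λ`-DSS about `e₃` with
`λ = e^{L/2} > 1` and the rotation `R_{−ωL}` (pinned by coordinates, angle `θ = −ωL`), Type I with the
same constant, with pressure bounded on every past slab, and not plainly `λ`-DSS at some point of the
past — exactly the hypotheses of `ClassicalCorkscrewSuffices` (`rotatingWave_data` plus: plain
`λ`-DSS on the whole past would make the profile `L`-periodic, `periodic_lerayOrbit_iff`, i.e. `V`
invariant under `R_{ωL}`). -/
theorem stub_classicalCorkscrewOfRelativeEquilibrium :
    (∃ (Rot : ℝ → (EuclideanSpace ℝ (Fin 3) ≃ₗᵢ[ℝ] EuclideanSpace ℝ (Fin 3))) (ω L C : ℝ)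
      (V : EuclideanSpace ℝ (Fin 3) → EuclideanSpace ℝ (Fin 3)) (Q : EuclideanSpace ℝ (Fin 3) → ℝ),
      (∀ (φ : ℝ) (x : EuclideanSpace ℝ (Fin 3)),
          Rot φ x 0 = Real.cos φ * x 0 - Real.sin φ * x 1 ∧
          Rot φ x 1 = Real.sin φ * x 0 + Real.cos φ * x 1 ∧ Rot φ x 2 = x 2) ∧
      0 < L ∧ ContDiff ℝ (⊤ : ℕ∞) V ∧ ContDiff ℝ (⊤ : ℕ∞) Q ∧
      Literature.Analysis.FluidPDE.VectorCalculus.IsDivFree V ∧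
      (∀ y : EuclideanSpace ℝ (Fin 3),
          ω • (Literature.Analysis.FluidPDE.cross (EuclideanSpace.single (2 : Fin 3) (1 : ℝ)) (V y)
                - fderiv ℝ V y (Literature.Analysis.FluidPDE.cross (EuclideanSpace.single (2 : Fin 3) (1 : ℝ)) y))
            + (1 / 2 : ℝ) • V y + (1 / 2 : ℝ) • fderiv ℝ V y y
            + Literature.Analysis.FluidPDE.convect V V y + gradient Q y
            = Laplacian.laplacian V y) ∧
      (∀ y : EuclideanSpace ℝ (Fin 3), (1 + ‖y‖) * ‖V y‖ ≤ C) ∧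
      (∀ y : EuclideanSpace ℝ (Fin 3), |Q y| ≤ C) ∧
      (∃ y : EuclideanSpace ℝ (Fin 3), Rot (ω * L) (V (Rot (-(ω * L)) y)) ≠ V y)) →
    ∃ (c θ C₀ : ℝ) (R : EuclideanSpace ℝ (Fin 3) ≃ₗᵢ[ℝ] EuclideanSpace ℝ (Fin 3))
      (u : ℝ → EuclideanSpace ℝ (Fin 3) → EuclideanSpace ℝ (Fin 3)) (p : ℝ → EuclideanSpace ℝ (Fin 3) → ℝ),
      1 < c ∧
      (∀ x : EuclideanSpace ℝ (Fin 3), R x 0 = Real.cos θ * x 0 - Real.sin θ * x 1 ∧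
          R x 1 = Real.sin θ * x 0 + Real.cos θ * x 1 ∧ R x 2 = x 2) ∧
      Literature.Analysis.FluidPDE.IsClassicalNSSolutionOn (Set.Iio 0) 1 0 u p ∧
      Literature.Analysis.FluidPDE.IsRotatedDSS c R u ∧
      Literature.Analysis.FluidPDE.HasTypeIDecay C₀ u ∧
      (∀ t < 0, Literature.Analysis.FluidPDE.IsBoundedOn (Set.Iic t) p) ∧
      (∃ t < 0, ∃ x, Literature.Analysis.FluidPDE.nsRescale c u t x ≠ u t x) := by
  rintro ⟨Rot, ω, L, C, V, Q, hRot, hL, hV, hQ, hdiv, hEq, hVb, hQb, y₀, hy₀⟩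
  obtain ⟨hcl, hrdss, hTI, hpb, -, -⟩ := rotatingWave_data (L := L) Rot ω V Q hRot hV hQ hdiv hEq hVb hQb
  set U : ℝ → (EuclideanSpace ℝ (Fin 3)) → (EuclideanSpace ℝ (Fin 3)) := fun s y => Rot (ω * s) (V (Rot (-(ω * s)) y)) with hU
  have hc1 : 1 < Real.exp (L / 2) := Real.one_lt_exp_iff.2 (by linarith)
  have hc0 : 0 < Real.exp (L / 2) := Real.exp_pos _
  have hlog : 2 * Real.log (Real.exp (L / 2)) = L := by rw [Real.log_exp]; ring
  have hUo : lerayOrbit (ofLerayOrbit U) = U := by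
    funext s y
    exact lerayOrbit_ofLerayOrbit U s y
  refine ⟨Real.exp (L / 2), -(ω * L), C, Rot (-(ω * L)), ofLerayOrbit U,
    ofLerayOrbitPressure fun s y => Q (Rot (-(ω * s)) y), hc1, hRot (-(ω * L)), hcl, hrdss, hTI, hpb, ?_⟩
  -- plain `λ`-DSS fails somewhere in the past: else `U` is `L`-periodic and `V` is `R_{ωL}`-invariant
  by_contra hall
  push Not at hall
  have hperiodic : Function.Periodic (lerayOrbit (ofLerayOrbit U)) (2 * Real.log (Real.exp (L / 2))) :=
    (periodic_lerayOrbit_iff hc0).2 fun t ht => funext (hall t ht)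
  have key := congrFun (hperiodic 0) y₀
  rw [hUo, zero_add, hlog] at key
  simp only [hU, mul_zero, neg_zero, rot_zero_apply Rot hRot] at key
  exact hy₀ key

/-- **The birth-line reduction: a non-axisymmetric relative equilibrium of the backward Leray system
suffices for `CorkscrewProfile`.** If the rotating steady Leray system (RE_ω) has a smooth
divergence-free solution `(V, Q)` in the Type-I envelope `(1 + ‖y‖)‖V‖ ≤ C`, `|Q| ≤ C` that is not
invariant under the rotation `R_{ωL}` for some `L > 0` (for the rotation family about `e₃` pinned by
coordinates), then route `CorkscrewDynamo`'s crux `CorkscrewProfile` holds: the rotating wave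
`u(t, x) = (−t)^{−1/2} R_{ωs} V(R_{−ωs} x/√(−t))`, `s = −log(−t)`, is a nontrivial Type-I ancient mild
solution, rotated `e^{L/2}`-DSS about `e₃` with essential rotation
(`stub_classicalCorkscrewOfRelativeEquilibrium` + the landed pad `classicalCorkscrewSuffices_proof`).
The hypothesis is verbatim the registered open stub `stub_relativeEquilibrium` of the line — the
existence problem for Type-I rotating self-similar profiles (Bradshaw–Tsai 2017 OP 5.1, Tsai 2018
Conj. 8.8–8.9, negative side) — so this theorem is the line's composition CLOSED MODULO that stub. -/
theorem corkscrewProfile_of_relativeEquilibrium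
    (stub_relativeEquilibrium : (∃ (Rot : ℝ → (EuclideanSpace ℝ (Fin 3) ≃ₗᵢ[ℝ] EuclideanSpace ℝ (Fin 3))) (ω L C : ℝ)
      (V : EuclideanSpace ℝ (Fin 3) → EuclideanSpace ℝ (Fin 3)) (Q : EuclideanSpace ℝ (Fin 3) → ℝ),
      (∀ (φ : ℝ) (x : EuclideanSpace ℝ (Fin 3)),
          Rot φ x 0 = Real.cos φ * x 0 - Real.sin φ * x 1 ∧
          Rot φ x 1 = Real.sin φ * x 0 + Real.cos φ * x 1 ∧ Rot φ x 2 = x 2) ∧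
      0 < L ∧ ContDiff ℝ (⊤ : ℕ∞) V ∧ ContDiff ℝ (⊤ : ℕ∞) Q ∧
      Literature.Analysis.FluidPDE.VectorCalculus.IsDivFree V ∧
      (∀ y : EuclideanSpace ℝ (Fin 3),
          ω • (Literature.Analysis.FluidPDE.cross (EuclideanSpace.single (2 : Fin 3) (1 : ℝ)) (V y)
                - fderiv ℝ V y (Literature.Analysis.FluidPDE.cross (EuclideanSpace.single (2 : Fin 3) (1 : ℝ)) y))
            + (1 / 2 : ℝ) • V y + (1 / 2 : ℝ) • fderiv ℝ V y y
            + Literature.Analysis.FluidPDE.convect V V y + gradient Q y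
            = Laplacian.laplacian V y) ∧
      (∀ y : EuclideanSpace ℝ (Fin 3), (1 + ‖y‖) * ‖V y‖ ≤ C) ∧
      (∀ y : EuclideanSpace ℝ (Fin 3), |Q y| ≤ C) ∧
      (∃ y : EuclideanSpace ℝ (Fin 3), Rot (ω * L) (V (Rot (-(ω * L)) y)) ≠ V y))) :
    Summit.NavierStokesRegularity.NavierStokesRegularity.Theses.CorkscrewDynamo.CorkscrewProfile := by
  have hpad := Summit.NavierStokesRegularity.NavierStokesRegularity.Theorems.classicalCorkscrewSuffices_proof
  unfold Summit.NavierStokesRegularity.NavierStokesRegularity.Theses.CorkscrewDynamo.ClassicalCorkscrewSuffices at hpad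
  exact hpad (stub_classicalCorkscrewOfRelativeEquilibrium stub_relativeEquilibrium)

end Summit.NavierStokesRegularity.NavierStokesRegularity.Theorems.CorkscrewProfile.Birth
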